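import Mathlib
import Literature.Probability.Percolation.SharpnessDCTProofs
import Literature.Probability.Percolation.TwoPointFunction
import Literature.Probability.Percolation.SlabCriticalityInputs
import Summits.CriticalPhenomena.PercolationContinuityZ3.Theorems.PercAxialLogConvexityAxialLogConvexStubLowerOfTransport
import HarnessLib

/-!
# `stub_upperOfTransport` of line `registered` (crux `AxialLogConvex`, stmt-CriticalPhenomena-11549)

Registered stub of the lead's skeleton `Cruxes/AxialLogConvex/Lines/birth.lean`, proved DEF-FREE.

Notation. `T_k = zdGraph 1 □ torusGraph 2 k` is the torus tube on `V_k = Site 1 × TorusSite 2 k`,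
`ι_k x = ((fun _ => x 0), Torus.proj k (Fin.tail x)) : Site 3 → V_k`, and
`Φ_k ω = (Sym2.map ι_k)⁻¹' ω` is the pull-back of a tube configuration to `ℤ³`; `B(m) = box 3 m`,
`∂B(m)` is its inner vertex boundary, and
`W_m(x) = {0 ↔ x in B(m)} ∪ ({0 ↔ ∂B(m) in B(m)} ∩ {x ↔ ∂B(m) in B(m)})`.

Statement. From the TRANSPORT hypothesis (`P^{T_k}(Φ_k⁻¹ A) = P^{ℤ³}(A)` for every event `A`
determined by the pairs of `B(m)`, `k ≥ 2m+2`) and the `ℤ³`-side limit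
(`P^{ℤ³}(W_m(x)) ≤ τ_p(0,x) + ε` eventually in `m`) deduce the upper approximation
`P_p^{T_k}(0 ↔ ((n), 0)) ≤ τ_p(0, n e₁) + ε` eventually in `k`.

Argument. Fix `p n ε`, `x = n e₁`; pick `m ≥ n` with `P^{ℤ³}(W_m(x)) ≤ τ + ε`; let
`k ≥ 2m+2`. KEY INCLUSION: for `ω ⊆ E(T_k)` with `0 ↔ ((n),0)` open, `Φ_k ω ∈ W_m(x)`. Indeed
`ι_k` is injective on `B(m)` (coordinates have modulus `≤ m < k/2`), so an open `T_k`-path inside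
`ι_k(B(m))` lifts to an open path of `Φ_k ω` inside `B(m)` (`pathIn_lift`); an open path from
`ι_k 0 = 0` to `ι_k x = ((n),0)` either stays inside `ι_k(B(m))` (then `0 ↔ x in B(m)` after
lifting) or its first exit edge `ι_k y ∼ c`, `c ∉ ι_k(B(m))`, has `c = ι_k z` for a
`ℤ³`-neighbour `z ∉ B(m)` of `y` (every `T_k`-neighbour of `ι_k y` is the image of a
`ℤ³`-neighbour of `y`), so `y ∈ ∂B(m)` and the prefix lifts to `0 ↔ y in B(m)`; the same from
the `x` end. MEASURE: `P^{T_k}(0 ↔ (n),0) ≤ P^{T_k}(Φ_k⁻¹ W_m) = P^{ℤ³}(W_m) ≤ τ + ε`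
(`real_mono_of_forall_subset_edgeSet`, transport, choice of `m`), where `W_m` is determined by
the pairs of `B(m)` (`DCT16.determinedBy_openConnIn`, closed under `∩`, complements and
bounded `∃`).

Tree lemmas used: `PathIn` API (`SitePaths.lean`: `refl`, `tail`, `symm`, `right_mem`,
`exit_or`), `pathIn_univ_of_reachable` (`SlabCriticalityInputs.lean`),
`DCT16.mem_openConnIn_of_pathIn`, `DCT16.determinedBy_openConnIn`, `DeterminedBy.inter`,
`DeterminedBy.compl`, `determinedBy_iff`, `DCT16.real_mono_of_forall_subset_edgeSet`,
`DCT16.adj_of_openGraph_adj`, `openGraph_adj`, `mem_innerBoundary_iff`, `zdGraph_adj_iff`,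
`torusGraph_adj_iff`, `Torus.proj_apply`, `mem_box`.
-/

noncomputable section

namespace Summit.CriticalPhenomena.PercolationContinuityZ3.Theorems.AxialLogConvex

open MeasureTheory Filter
open Literature.Probability.Percolation Literature.Probability.LatticeModels

namespace StubUpperOfTransport

/-! ### Paths: lifting along a map injective on a set -/

/-- **Lifting of open paths along a map injective on `B`.** If `ι` is injective on `B`, an open
path of the configuration `ω` (on the target) from `ι y₀`, `y₀ ∈ B`, staying inside `ι '' B`,
lifts to an open path inside `B` of the pulled-back configuration `(Sym2.map ι)⁻¹' ω` from `y₀`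
to the `B`-preimage of its endpoint. [folklore] -/
theorem pathIn_lift {V W : Type*} (ι : V → W) {B : Set V} (hinj : Set.InjOn ι B)
    (ω : BondConfig W) {y₀ : V} (hy₀ : y₀ ∈ B) {R : Set W} (hR : R ⊆ ι '' B) {w : W}
    (h : PathIn (openGraph ω) R (ι y₀) w) :
    ∀ y ∈ B, ι y = w → PathIn (openGraph (Sym2.map ι ⁻¹' ω)) B y₀ y := by
  obtain ⟨h0, hr⟩ := h
  induction hr with
  | refl =>
    intro y hy hyw
    obtain rfl : y = y₀ := hinj hy hy₀ hyw
    exact PathIn.refl hy₀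
  | @tail b c hub hbc ih =>
    intro y hy hyw
    obtain ⟨yb, hybB, hybeq⟩ :=
      hR (PathIn.right_mem (show PathIn (openGraph ω) R (ι y₀) b from ⟨h0, hub⟩))
    refine (ih yb hybB hybeq).tail ?_ hy
    obtain ⟨hadj, -⟩ := hbc
    rw [openGraph_adj] at hadj ⊢
    obtain ⟨hmem, hne⟩ := hadj
    refine ⟨?_, ?_⟩
    · show Sym2.map ι s(yb, y) ∈ ω
      rw [Sym2.map_mk, hybeq, hyw]
      exact hmem
    · rintro rfl
      exact hne (hybeq.symm.trans hyw)

/-! ### Geometry of `ι_k : ℤ³ → ℤ × (ℤ/kℤ)²` -/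

/-- `ι_k` is injective on the box `B(m)` once `k ≥ 2m+2`: two coordinates of modulus `≤ m` that
agree mod `k > 2m` are equal. [folklore] -/
theorem iota_injOn {m k : ℕ} (hk : 2 * m + 2 ≤ k) :
    Set.InjOn (fun x : Site 3 => ((fun _ : Fin 1 => x 0), Torus.proj k (Fin.tail x)))
      (↑(box 3 m) : Set (Site 3)) := by
  intro a ha b hb hab
  simp only [Prod.mk.injEq] at hab
  obtain ⟨h0, htail⟩ := hab
  rw [Finset.mem_coe, mem_box] at ha hb
  funext j
  refine Fin.cases ?_ (fun i => ?_) j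
  · exact congr_fun h0 0
  · have hi := congr_fun htail i
    simp only [Torus.proj_apply, Fin.tail] at hi
    rw [ZMod.intCast_eq_intCast_iff_dvd_sub] at hi
    have ha' := ha i.succ
    have hb' := hb i.succ
    have habs : |b i.succ - a i.succ| < (k : ℤ) := by
      rw [abs_lt]; omega
    have := Int.eq_zero_of_abs_lt_dvd hi habs
    omega

/-- Every `T_k`-neighbour of `ι_k y` is `ι_k z` for a `ℤ³`-neighbour `z` of `y`: a move of the
`ℤ`-coordinate is `z = y ± e₀`, a move `± eᵢ` of a torus coordinate is `z = y ± e_{i+1}`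
(`Int.cast` is additive). [folklore] -/
theorem exists_adj_of_adj_iota {k : ℕ} (y : Site 3) (c : Site 1 × TorusSite 2 k)
    (h : ((zdGraph 1) □ (torusGraph 2 k)).Adj
      ((fun _ : Fin 1 => y 0), Torus.proj k (Fin.tail y)) c) :
    ∃ z : Site 3, (zdGraph 3).Adj y z ∧
      ((fun _ : Fin 1 => z 0), Torus.proj k (Fin.tail z)) = c := by
  rcases SimpleGraph.boxProd_adj.1 h with ⟨h1, h2⟩ | ⟨h1, h2⟩
  · -- the `ℤ`-coordinate moves
    dsimp only at h1 h2
    obtain ⟨i, hi | hi⟩ := (zdGraph_adj_iff _ _).1 h1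
    · refine ⟨y + Pi.single 0 1, (zdGraph_adj_iff _ _).2 ⟨0, Or.inl rfl⟩, Prod.ext ?_ ?_⟩
      · funext j
        have hij := congr_fun hi j
        have hi0 : i = 0 := Fin.eq_zero i
        subst hi0
        have hj0 : j = 0 := Fin.eq_zero j
        subst hj0
        simp only [Pi.add_apply, Pi.single_eq_same] at hij ⊢
        exact hij.symm
      · rw [← h2]
        funext j
        simp [Fin.tail, Fin.succ_ne_zero]
    · refine ⟨y - Pi.single 0 1, (zdGraph_adj_iff _ _).2 ⟨0, Or.inr (by simp)⟩,
        Prod.ext ?_ ?_⟩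
      · funext j
        have hij := congr_fun hi j
        have hi0 : i = 0 := Fin.eq_zero i
        subst hi0
        have hj0 : j = 0 := Fin.eq_zero j
        subst hj0
        simp only [Pi.add_apply, Pi.single_eq_same, Pi.sub_apply] at hij ⊢
        omega
      · rw [← h2]
        funext j
        simp [Fin.tail, Fin.succ_ne_zero]
  · -- a torus coordinate moves
    dsimp only at h1 h2
    obtain ⟨-, ⟨i, hi⟩ | ⟨i, hi⟩⟩ := (torusGraph_adj_iff _ _).1 h1
    · refine ⟨y + Pi.single i.succ 1, (zdGraph_adj_iff _ _).2 ⟨i.succ, Or.inl rfl⟩,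
        Prod.ext ?_ ?_⟩
      · rw [← h2]
        funext j
        simp [(Fin.succ_ne_zero i).symm]
      · rw [hi]
        funext j
        rcases eq_or_ne j i with rfl | hji
        · simp [Fin.tail]
        · simp [Fin.tail, hji, (Fin.succ_injective _).ne hji]
    · refine ⟨y - Pi.single i.succ 1, (zdGraph_adj_iff _ _).2 ⟨i.succ, Or.inr (by simp)⟩,
        Prod.ext ?_ ?_⟩
      · rw [← h2]
        funext j
        simp [(Fin.succ_ne_zero i).symm]
      · have hi' : c.2 = Torus.proj k (Fin.tail y) - Pi.single i 1 :=
          eq_sub_of_add_eq hi.symm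
        rw [hi']
        funext j
        rcases eq_or_ne j i with rfl | hji
        · simp [Fin.tail]
        · simp [Fin.tail, hji, (Fin.succ_injective _).ne hji]

/-! ### The key inclusion `{0 ↔ ((n),0)} ⊆ Φ_k⁻¹ W_m` on lattice configurations -/

/-- **Key inclusion.** For `k ≥ 2m+2`, `n ≤ m` and a tube configuration `ω ⊆ E(T_k)` in which
`0 ↔ ((n), 0)`, the pulled-back configuration `Φ_k ω` lies in
`W_m = {0 ↔ n e₁ in B(m)} ∪ ({0 ↔ ∂B(m) in B(m)} ∩ {n e₁ ↔ ∂B(m) in B(m)})`. [folklore] -/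
theorem preimage_mem_W {m k n : ℕ} (hk : 2 * m + 2 ≤ k) (hn : n ≤ m)
    {ω : BondConfig (Site 1 × TorusSite 2 k)}
    (hω : ω ⊆ ((zdGraph 1) □ (torusGraph 2 k)).edgeSet)
    (hconn : ω ∈ openConn (0 : Site 1 × TorusSite 2 k) ((fun _ => (n : ℤ)), 0)) :
    (Sym2.map (fun x : Site 3 => ((fun _ : Fin 1 => x 0), Torus.proj k (Fin.tail x)))) ⁻¹' ω ∈
      openConnIn (↑(box 3 m) : Set (Site 3)) 0 (Pi.single 0 (n : ℤ)) ∪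
        ({ω | ∃ y ∈ innerBoundary (zdGraph 3) (box 3 m),
            ω ∈ openConnIn (↑(box 3 m) : Set (Site 3)) 0 y} ∩
          {ω | ∃ y ∈ innerBoundary (zdGraph 3) (box 3 m),
            ω ∈ openConnIn (↑(box 3 m) : Set (Site 3)) (Pi.single 0 (n : ℤ)) y}) := by
  set ι : Site 3 → Site 1 × TorusSite 2 k :=
    fun x => ((fun _ : Fin 1 => x 0), Torus.proj k (Fin.tail x)) with hι
  set x : Site 3 := Pi.single 0 (n : ℤ) with hx
  have hinj : Set.InjOn ι (↑(box 3 m) : Set (Site 3)) := iota_injOn hk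
  have h0B : (0 : Site 3) ∈ (↑(box 3 m) : Set (Site 3)) := Finset.mem_coe.2 (zero_mem_box 3 m)
  have hxB : x ∈ (↑(box 3 m) : Set (Site 3)) := by
    rw [Finset.mem_coe, mem_box]
    intro i
    rcases eq_or_ne i 0 with rfl | hi
    · simp [hx]; omega
    · simp [hx, hi]
  -- one-ended analysis: an open `T_k`-path from `ι a` to `ι b` (`a, b ∈ B(m)`) either lifts to an
  -- open path `a ↔ b in B(m)` of `Φ ω`, or gives an arm `a ↔ y in B(m)` to some `y ∈ ∂B(m)`.
  have arm : ∀ a b : Site 3, a ∈ (↑(box 3 m) : Set (Site 3)) →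
      b ∈ (↑(box 3 m) : Set (Site 3)) → PathIn (openGraph ω) Set.univ (ι a) (ι b) →
      PathIn (openGraph (Sym2.map ι ⁻¹' ω)) (↑(box 3 m)) a b ∨
        ∃ y ∈ innerBoundary (zdGraph 3) (box 3 m),
          PathIn (openGraph (Sym2.map ι ⁻¹' ω)) (↑(box 3 m)) a y := by
    intro a b ha hb hp
    rcases hp.exit_or (R := ι '' (↑(box 3 m) : Set (Site 3))) ⟨a, ha, rfl⟩ with
      hin | ⟨c, e, hc, he, -, hce, hpre⟩
    · exact Or.inl (pathIn_lift ι hinj ω ha Set.inter_subset_left hin b hb rfl)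
    · obtain ⟨y, hy, rfl⟩ := hc
      refine Or.inr ⟨y, ?_, pathIn_lift ι hinj ω ha Set.inter_subset_left hpre y hy rfl⟩
      obtain ⟨z, hyz, hz⟩ := exists_adj_of_adj_iota y e (DCT16.adj_of_openGraph_adj hω hce)
      rw [mem_innerBoundary_iff]
      exact ⟨hy, z, fun hzB => he ⟨z, Finset.mem_coe.2 hzB, hz⟩, hyz⟩
  have hp : PathIn (openGraph ω) Set.univ (ι 0) (ι x) := by
    have h0 : ι 0 = 0 := StubLowerOfTransport.iota_zero k
    have hxι : ι x = ((fun _ => (n : ℤ)), 0) := StubLowerOfTransport.iota_single k n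
    rw [h0, hxι]
    exact pathIn_univ_of_reachable hconn
  rcases arm 0 x h0B hxB hp with h | ⟨y, hy, hpy⟩
  · exact Or.inl (DCT16.mem_openConnIn_of_pathIn h)
  rcases arm x 0 hxB h0B hp.symm with h' | ⟨y', hy', hpy'⟩
  · exact Or.inl (DCT16.mem_openConnIn_of_pathIn h'.symm)
  exact Or.inr ⟨⟨y, hy, DCT16.mem_openConnIn_of_pathIn hpy⟩,
    ⟨y', hy', DCT16.mem_openConnIn_of_pathIn hpy'⟩⟩

/-! ### Finite dependence of `W_m` -/

/-- `{a ↔ T in S}` (a bounded existential of connection events inside `S`) is determined by any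
`K ⊇ S.sym2`. [folklore] -/
theorem determinedBy_setOf_exists_openConnIn {V : Type*} (S : Set V) (T : Finset V) (a : V)
    {K : Set (Sym2 V)} (hK : S.sym2 ⊆ K) :
    DeterminedBy {ω : BondConfig V | ∃ y ∈ T, ω ∈ openConnIn S a y} K := by
  rw [determinedBy_iff]
  intro ω ω' h
  simp only [Set.mem_setOf_eq]
  exact exists_congr fun y => and_congr_right fun _ =>
    (determinedBy_iff _ _).1 (DCT16.determinedBy_openConnIn S a y hK) ω ω' h

/-- `W_m(x)` is determined by the pairs of the box `B(m)`. [folklore] -/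
theorem determinedBy_W (m : ℕ) (x : Site 3) :
    DeterminedBy
      (openConnIn (↑(box 3 m) : Set (Site 3)) 0 x ∪
        ({ω | ∃ y ∈ innerBoundary (zdGraph 3) (box 3 m),
            ω ∈ openConnIn (↑(box 3 m) : Set (Site 3)) 0 y} ∩
          {ω | ∃ y ∈ innerBoundary (zdGraph 3) (box 3 m),
            ω ∈ openConnIn (↑(box 3 m) : Set (Site 3)) x y}))
      (↑((box 3 m).sym2) : Set (Sym2 (Site 3))) := by
  have hK : (↑(box 3 m) : Set (Site 3)).sym2 ⊆ (↑((box 3 m).sym2) : Set (Sym2 (Site 3))) :=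
    by rw [Finset.coe_sym2]
  have hA := DCT16.determinedBy_openConnIn (↑(box 3 m) : Set (Site 3)) 0 x hK
  have hB :=
    (determinedBy_setOf_exists_openConnIn _ (innerBoundary (zdGraph 3) (box 3 m)) 0 hK).inter
      (determinedBy_setOf_exists_openConnIn _ (innerBoundary (zdGraph 3) (box 3 m)) x hK)
  -- binary union via complements (`DeterminedBy.compl`, `DeterminedBy.inter`)
  have h := (hA.compl.inter hB.compl).compl
  rwa [← Set.compl_union, compl_compl] at h

end StubUpperOfTransport

open StubUpperOfTransport in
/-- **stub_upperOfTransport** (registered stub of line `registered`, crux `AxialLogConvex`).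
Transport and the `ℤ³`-side limit ⇒ the upper approximation
`P_p^{T_k}(0 ↔ n e₁) ≤ τ_p(0, n e₁) + ε` eventually in `k`: for `k ≥ 2m+2` and a tube
configuration `ω' ⊆ E(T_k)`, an open path from `0 = ι_k 0` to `((n),0) = ι_k(n e₁)` either
stays inside `ι_k(B(m))` — then it pulls back to an open path of `ℤ³` inside `B(m)` — or leaves
it, and its first exit (from either end) is at the image of a point of `∂B(m)`; hence
`{0 ↔ (n),0} ⊆ Φ_k⁻¹ W_m` a.s.,
`P^{T_k}(0 ↔ (n),0) ≤ P^{T_k}(Φ_k⁻¹ W_m) = P^{ℤ³}(W_m) ≤ τ + ε`.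
[folklore; Grimmett 1999 §1.6, §8.3] -/
theorem stub_upperOfTransport :
    (∀ (m k : ℕ), 2 * m + 2 ≤ k → ∀ (p : unitInterval) (A : Set (Literature.Probability.Percolation.BondConfig (Literature.Probability.LatticeModels.Site 3))), Literature.Probability.Percolation.DeterminedBy A (↑((Literature.Probability.LatticeModels.box 3 m).sym2) : Set (Sym2 (Literature.Probability.LatticeModels.Site 3))) → (Literature.Probability.Percolation.bondPercolation ((Literature.Probability.LatticeModels.zdGraph 1).boxProd (Literature.Probability.LatticeModels.torusGraph 2 k)) p).real {ω : Literature.Probability.Percolation.BondConfig (Literature.Probability.LatticeModels.Site 1 × Literature.Probability.LatticeModels.TorusSite 2 k) | (Sym2.map (fun x : Literature.Probability.LatticeModels.Site 3 => ((fun _ : Fin 1 => x 0), Literature.Probability.LatticeModels.Torus.proj k (Fin.tail x)))) ⁻¹' ω ∈ A} = (Literature.Probability.Percolation.bondPercolation (Literature.Probability.LatticeModels.zdGraph 3) p).real A) →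
    (∀ (p : unitInterval) (x : Literature.Probability.LatticeModels.Site 3) (ε : ℝ), 0 < ε → ∀ᶠ m : ℕ in Filter.atTop, (Literature.Probability.Percolation.bondPercolation (Literature.Probability.LatticeModels.zdGraph 3) p).real (Literature.Probability.Percolation.openConnIn (↑(Literature.Probability.LatticeModels.box 3 m) : Set (Literature.Probability.LatticeModels.Site 3)) 0 x ∪ ({ω | ∃ y ∈ Literature.Probability.LatticeModels.innerBoundary (Literature.Probability.LatticeModels.zdGraph 3) (Literature.Probability.LatticeModels.box 3 m), ω ∈ Literature.Probability.Percolation.openConnIn (↑(Literature.Probability.LatticeModels.box 3 m) : Set (Literature.Probability.LatticeModels.Site 3)) 0 y} ∩ {ω | ∃ y ∈ Literature.Probability.LatticeModels.innerBoundary (Literature.Probability.LatticeModels.zdGraph 3) (Literature.Probability.LatticeModels.box 3 m), ω ∈ Literature.Probability.Percolation.openConnIn (↑(Literature.Probability.LatticeModels.box 3 m) : Set (Literature.Probability.LatticeModels.Site 3)) x y})) ≤ Literature.Probability.Percolation.tau 3 p 0 x + ε) →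
    ∀ (p : unitInterval) (n : ℕ) (ε : ℝ), 0 < ε → ∀ᶠ k : ℕ in Filter.atTop, (Literature.Probability.Percolation.bondPercolation ((Literature.Probability.LatticeModels.zdGraph 1).boxProd (Literature.Probability.LatticeModels.torusGraph 2 k)) p).real (Literature.Probability.Percolation.openConn (0 : Literature.Probability.LatticeModels.Site 1 × Literature.Probability.LatticeModels.TorusSite 2 k) ((fun _ => (n : ℤ)), 0)) ≤ Literature.Probability.Percolation.tau 3 p 0 (Pi.single 0 (n : ℤ)) + ε := by
  intro hT hU p n ε hε
  obtain ⟨m, hm, hnm⟩ :=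
    ((hU p (Pi.single 0 (n : ℤ)) ε hε).and (Filter.eventually_ge_atTop n)).exists
  refine Filter.eventually_atTop.2 ⟨2 * m + 2, fun k hk => ?_⟩
  haveI : NeZero k := ⟨by omega⟩
  have htrans := hT m k hk p _ (determinedBy_W m (Pi.single 0 (n : ℤ)))
  exact (DCT16.real_mono_of_forall_subset_edgeSet _ p fun ω hω hc =>
    preimage_mem_W hk hnm hω hc).trans (htrans.trans_le hm)

end Summit.CriticalPhenomena.PercolationContinuityZ3.Theorems.AxialLogConvex

end
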